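/-
PORT-SPLIT (pub-hodgecm2, COR-CM cell; slot b06, BINDER-OWNERS §8): the single definition of the stage-1 package file
`HodgeCMPerL/HodgeCM/Proofs/Pohlmann/PohlmannEq.lean` (pub-hodgecm HOME/lean, bytes of record md5 5c8e76b73e5f) —
`Universe.PohlmannBasis : Universe → Prop` (Pohlmann's theorem in print form, as a statement) — hoisted VERBATIM (docstring,
binders, body, fully-qualified name) into this definition-only file, so that its review (D-0009) runs early and off the critical
path of the landing DAG; the port of the rest of that file (kit #34 `Proofs/Pohlmann/PohlmannEq.lean`, theorems only, which
PROVES it: `pohlmannBasis_holds`, `pohlmannBasis_of_facts`) imports this module. No other edit. Nothing is asserted here.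
-/
import Summits.HodgeConjecture.CorCM.Geometry.WeightFacts

/-!
# Pohlmann's theorem in PRINT form — the statement `Universe.PohlmannBasis`

Gao–Ullmo, *J. Inst. Math. Jussieu* 25 (2025) 215–249 = arXiv:2411.12249, Theorem 3.1 "(Pohlmann)", p. 9 ll. 32–37
(after Pohlmann, *Ann. of Math.* 88 (1968) 161–180, Thm 1), in CM-algebra form over an abstract `U : Universe`:
`B^p(A′) ⊗ ℂ = ⨆_{S Hodge weight} V_S` for `A′ = ∏_{j ≤ n} A_{(F,Θ_j)}`, `F` a Galois CM field.  Proved (not assumed) in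
`Summits.HodgeConjecture.CorCM.Proofs.Pohlmann.PohlmannEq`; the carrier-level theorem for actual CM abelian varieties is
`Literature.AlgebraicGeometry.Pohlmann1968.Pohlmann1968_thm1_product_holds`.
-/

noncomputable section

open scoped TensorProduct

namespace Summit.HodgeConjecture.CorCM

open Literature.AlgebraicGeometry.Motives (CMType)

namespace Universe

/-- **Pohlmann's theorem, print form** (Gao–Ullmo, *J. Inst. Math. Jussieu* 25 (2025), Thm 3.1 "(Pohlmann)",
p. 9 ll. 32–37: "`B^p(A) ⊗ ℂ` has a basis consisting of `[P]` for those `P` with `|P| = 2p` such that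
`|σP ∩ Φ| = |σP ∩ Φ̄|` for all `σ ∈ G`"; Pohlmann, *Ann. of Math.* 88 (1968) Thm 1), in CM-algebra form for the
products `A′ = ∏_{j ≤ n} A_{(F,Θ_j)}`, `F` a Galois CM field: the complexified rational Hodge classes
`B^p(A′) ⊗ ℂ ⊆ H^{2p}(A′, ℂ)` are EXACTLY the sum of the weight spaces `V_S` of the Hodge weights `S`
(`IsHodgeWeight Θ p S`: `|S| = 2p` and every Galois translate of `S` has type `(p,p)`).  The sum is direct
(`iSupIndep_weightSpace_hodge`).  Compare `PohlmannSpan` (= the inclusion `⊆`, with the extra hypothesis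
`6 ≤ [F:ℚ]` of its consumer QW8 L2.2). -/
def PohlmannBasis (U : Universe) : Prop :=
  ∀ (F : CMField), IsGalois ℚ F → ∀ (n : ℕ) (Θ : Fin (n + 1) → CMType F) (p : ℕ),
    (U.hodgeClassesOf (U.cmProd F Θ) p).baseChange ℂ =
      ⨆ (S : Fin (n + 1) → Finset ((F : Type) →+* ℂ)) (_ : IsHodgeWeight Θ p S),
        U.weightSpace F Θ S (2 * p)

end Universe

end Summit.HodgeConjecture.CorCM

end
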